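import Summits.HodgeConjecture.HodgeConjecture.Theorems.LinearSystemTorelliDefs
import Literature.AlgebraicGeometry.HodgeTheory.AbelianVarietyEndomorphismsHOne
import Mathlib.LinearAlgebra.Vandermonde
import Mathlib.LinearAlgebra.Matrix.Adjugate
import Mathlib.RingTheory.MvPolynomial.Homogeneous
import Mathlib.Algebra.MvPolynomial.CommRing
import Mathlib.Algebra.Polynomial.Coeff
import Mathlib.Algebra.Polynomial.AlgebraMap

/-!
# Route LinearSystemTorelli — crux `MiddleDivisorSupport`, line `ch0-null-correspondence-support`:
# stub S1 `stub_weilProjectorCoefficients` (Weil-projector coefficients exist)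

The registered stub S1 of the skeleton `Cruxes/MiddleDivisorSupport/Lines/ch0_null_correspondence_support`
(crux stmt-HodgeConjecture-1081), statement `WeilProjectorCoefficients` of
`Theorems/LinearSystemTorelliDefs`: for all `n, d ≥ 1` there are finitely supported integers
`q : ℕ × ℕ →₀ ℤ` and `m ≥ 1` with
`Σ q(x,y) · (x + y i√d)ᵃ (x - y i√d)ᵇ = m · 𝟙[(a,b) ∈ {(2n,0),(0,2n)}]` for all `0 ≤ a, b ≤ 2n`
(`IsWeilProjectorCoefficients n d q m`), i.e. the cycle `Σ q(x,y) Γ_{x·𝟙 + y·φ}` acts on the `K`-type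
`(a,b)` pieces of `H^•(A)` as `m` times the projector onto the Weil plane (van Geemen 1994, proof of
Thm. 6.12: the Weil classes are cut out by the `K^×`-multiplications). PROVED here, unconditionally;
pure algebra.

## Proof (Vandermonde extraction of a coefficient functional)

Write `ι = i√d`, so `ι² = -d`, and `F_{a,b} = (X₀ + ι X₁)ᵃ (X₀ - ι X₁)ᵇ ∈ ℂ[X₀, X₁]` (homogeneous of
degree `a + b ≤ 4n`), so that `(x + y i√d)ᵃ (x - y i√d)ᵇ = F_{a,b}(x, y)`.
* FUNCTIONAL. Substituting `X₀ ↦ s·T`, `X₁ ↦ T` sends `c·X₀ʲX₁ᵏ ↦ c sʲ T^{j+k}`, hence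
  `[T^{2n}] F(sT, T) = Σ_{j+k=2n} sʲ [X₀ʲX₁ᵏ] F`; and `F_{a,b}(sT,T) = (s+ι)ᵃ(s-ι)ᵇ T^{a+b}`. Adding the
  cases `s = ±ι`: `Σ_{j+k=2n} (ιʲ + (-ι)ʲ)·[X₀ʲX₁ᵏ] F_{a,b} = 𝟙[a+b=2n]·((2ι)ᵃ0ᵇ + 0ᵃ(-2ι)ᵇ)
  = 𝟙_S(a,b) · (2ι)^{2n}` for `a, b ≤ 2n`, `n ≥ 1`; the weights `e_j = ιʲ + (-ι)ʲ` are the INTEGERS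
  `2(-d)^{j/2}` (`j` even), `0` (`j` odd).
* EXTRACTION. Let `V` be the integer Vandermonde matrix on the nodes `0, 1, …, 4n` (`det V ≠ 0`),
  `W_{jk} = 𝟙[j+k=2n] e_j` and `L = (adj V)ᵀ W (adj V)` (integer matrices). Since `adj V · V = det V · 1`,
  `Vᵀ L V = (det V)² W`, i.e. `Σ_{x,y} xʲ L_{xy} yᵏ = (det V)² W_{jk}` for `j, k ≤ 4n`: the grid functional
  `G ↦ Σ_{x,y ≤ 4n} L_{xy} G(x,y)` is `(det V)²·Σ_{j+k=2n} e_j [X₀ʲX₁ᵏ]` on polynomials of bidegree `≤ 4n`.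
* Hence `Σ_{x,y} L_{xy} F_{a,b}(x,y) = (det V)² 𝟙_S(a,b) (2ι)^{2n} = (det V)² (-4d)ⁿ 𝟙_S(a,b)`; take
  `q(x,y) = (-1)ⁿ L_{xy}` on the grid `[0,4n]²` and `m = |det V|² (4d)ⁿ ≥ 1`.

No new definitions and no notation (the matrices and `F_{a,b}` are local to the proof, passed to the
helper lemmas as `hV : V = …`, `hW : W = …`, `hF : F = …`); helper lemmas are general
(`transpose_mul_sandwich_mul`: `Vᵀ (adj V)ᵀ W (adj V) V = (det V)² W` for any square `V, W`);
`ι² = -d` is the tree's `Literature.AlgebraicGeometry.HodgeTheory.I_mul_sqrt_sq`. NOT here: the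
neighbouring stubs S2, S3, F1–F3 of the line, and any geometry — this file is the arithmetic input
`IsWeilProjectorCoefficients` consumed by the skeleton's `corrAct_weilProjector_eq_smul`.

## References

* [vanGeemen1994HodgeAV] B. van Geemen, An introduction to the Hodge conjecture for abelian varieties,
  proof of Thm. 6.12 (the source of the statement; the proof here is elementary linear algebra).
-/

noncomputable section

-- `Summit.HodgeConjecture.HodgeConjecture.Theorems` is the mandated namespace (single-problem summit:
-- Problem = Summit), which `linter.dupNamespace` flags on every declaration; the lakefile turns the
-- linter off tree-wide (weak option), restated here so stand-alone elaboration is warning-free too.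
set_option linter.dupNamespace false

namespace Summit.HodgeConjecture.HodgeConjecture.Theorems.Ch0Null

open scoped BigOperators

namespace WeilProjectorCoeff

open MvPolynomial

/-! ### Linear algebra: the Vandermonde sandwich -/

/-- For square matrices `V, W` over a commutative ring: `Vᵀ · ((adj V)ᵀ · W · adj V) · V = (det V)² • W`
(from `adj V · V = det V · 1`). -/
theorem transpose_mul_sandwich_mul {m R : Type*} [Fintype m] [DecidableEq m] [CommRing R]
    (V W : Matrix m m R) :
    V.transpose * (V.adjugate.transpose * W * V.adjugate) * V = (V.det ^ 2) • W := by
  have hAV : V.adjugate * V = V.det • (1 : Matrix m m R) := Matrix.adjugate_mul V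
  have hT : V.transpose * V.adjugate.transpose = V.det • (1 : Matrix m m R) := by
    rw [← Matrix.transpose_mul, hAV, Matrix.transpose_smul, Matrix.transpose_one]
  calc V.transpose * (V.adjugate.transpose * W * V.adjugate) * V
      = V.transpose * V.adjugate.transpose * W * (V.adjugate * V) := by
        simp only [Matrix.mul_assoc]
    _ = (V.det ^ 2) • W := by
        rw [hT, hAV]
        simp only [Matrix.smul_mul, Matrix.mul_smul, Matrix.one_mul, Matrix.mul_one, smul_smul, sq]

/-- Entrywise form of `transpose_mul_sandwich_mul`: the moments of `L = (adj V)ᵀ W (adj V)` against the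
columns of `V` are `(det V)² W`. -/
theorem sum_sum_sandwich {m R : Type*} [Fintype m] [DecidableEq m] [CommRing R]
    (V W : Matrix m m R) (j k : m) :
    ∑ x, ∑ y, V x j * (V.adjugate.transpose * W * V.adjugate) x y * V y k = V.det ^ 2 * W j k := by
  set L := V.adjugate.transpose * W * V.adjugate with hL
  have h := congrFun (congrFun (transpose_mul_sandwich_mul V W) j) k
  rw [← hL] at h
  simp only [Matrix.mul_apply, Matrix.smul_apply, smul_eq_mul, Matrix.transpose_apply,
    Finset.sum_mul] at h
  rw [Finset.sum_comm]
  exact h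

/-- The integer Vandermonde matrix on the nodes `0, 1, …, N` is non-singular. -/
theorem det_vandermonde_natCast_ne_zero (N : ℕ) :
    (Matrix.vandermonde fun i : Fin (N + 1) => ((i : ℕ) : ℤ)).det ≠ 0 := by
  rw [Matrix.det_vandermonde_ne_zero_iff]
  intro i j h
  dsimp only at h
  apply Fin.ext
  exact_mod_cast h

/-! ### Polynomial algebra: the character polynomial and the substitution `X₀ ↦ s·T, X₁ ↦ T` -/

/-- The character polynomial `F_{a,b} = (X₀ + ι X₁)ᵃ (X₀ - ι X₁)ᵇ ∈ ℂ[X₀, X₁]` is homogeneous of degree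
`a + b`. -/
theorem isHomogeneous_charPoly (ι : ℂ) (a b : ℕ) :
    ((X 0 + C ι * X 1) ^ a * (X 0 - C ι * X 1) ^ b : MvPolynomial (Fin 2) ℂ).IsHomogeneous (a + b) := by
  have h1 : (X 0 + C ι * X 1 : MvPolynomial (Fin 2) ℂ).IsHomogeneous 1 :=
    (isHomogeneous_X ℂ 0).add (isHomogeneous_C_mul_X ι 1)
  have h2 : (X 0 - C ι * X 1 : MvPolynomial (Fin 2) ℂ).IsHomogeneous 1 :=
    (isHomogeneous_X ℂ 0).sub (isHomogeneous_C_mul_X ι 1)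
  simpa using (h1.pow a).mul (h2.pow b)

/-- Exponents in the support of `F_{a,b}` are at most `a + b`. -/
theorem le_of_mem_support_charPoly {ι : ℂ} {a b : ℕ} {F : MvPolynomial (Fin 2) ℂ}
    (hF : F = (X 0 + C ι * X 1) ^ a * (X 0 - C ι * X 1) ^ b) {m : Fin 2 →₀ ℕ} (hm : m ∈ F.support)
    (i : Fin 2) : m i ≤ a + b := by
  subst hF
  have h := (isHomogeneous_charPoly ι a b).degree_eq_sum_deg_support hm
  calc m i ≤ m.degree := Finsupp.le_degree i m
    _ = a + b := by rw [Finsupp.degree_apply]; exact h.symm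

/-- Evaluation of a polynomial in two variables as a sum over its support. -/
theorem eval_eq_sum_support (x y : ℂ) (F : MvPolynomial (Fin 2) ℂ) :
    eval ![x, y] F = ∑ m ∈ F.support, coeff m F * (x ^ m 0 * y ^ m 1) := by
  rw [eval_eq']
  simp [Fin.prod_univ_two]

/-- `weilCharacter d x y a b = F_{a,b}(x, y)` for `ι = i√d`. -/
theorem weilCharacter_eq_eval {ι : ℂ} {d : ℕ} (hι : ι = Complex.I * (Real.sqrt d : ℂ)) {a b : ℕ}
    {F : MvPolynomial (Fin 2) ℂ} (hF : F = (X 0 + C ι * X 1) ^ a * (X 0 - C ι * X 1) ^ b)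
    (x y : ℕ) : weilCharacter d x y a b = eval ![(x : ℂ), (y : ℂ)] F := by
  subst hι hF
  rw [weilCharacter]
  simp only [map_mul, map_pow, map_add, map_sub, eval_X, eval_C, Matrix.cons_val_zero,
    Matrix.cons_val_one]
  ring

/-- The substitution `X₀ ↦ s·T`, `X₁ ↦ T` on a monomial: `c X₀ʲ X₁ᵏ ↦ c sʲ T^{j+k}`. -/
theorem subst_monomial (s : ℂ) (m : Fin 2 →₀ ℕ) (c : ℂ) :
    aeval ![Polynomial.C s * Polynomial.X, Polynomial.X] (monomial m c) =
      Polynomial.C (c * s ^ m 0) * Polynomial.X ^ (m 0 + m 1) := by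
  rw [aeval_monomial, Finsupp.prod_pow, Fin.prod_univ_two]
  simp only [Polynomial.algebraMap_eq, Matrix.cons_val_zero, Matrix.cons_val_one, map_mul, map_pow]
  ring

/-- Coefficients after substitution: `[T^K] F(sT, T) = Σ_{j+k=K} sʲ [X₀ʲX₁ᵏ] F`. -/
theorem coeff_subst (s : ℂ) (F : MvPolynomial (Fin 2) ℂ) (K : ℕ) :
    (aeval ![Polynomial.C s * Polynomial.X, Polynomial.X] F).coeff K =
      ∑ m ∈ F.support, coeff m F * (if m 0 + m 1 = K then s ^ m 0 else 0) := by
  conv_lhs => rw [F.as_sum, map_sum, Polynomial.finsetSum_coeff]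
  refine Finset.sum_congr rfl fun m _ => ?_
  rw [subst_monomial, Polynomial.coeff_C_mul_X_pow]
  by_cases h : m 0 + m 1 = K
  · rw [if_pos h, if_pos h.symm]
  · rw [if_neg h, if_neg (Ne.symm h), mul_zero]

/-- The substitution on the character polynomial: `F_{a,b}(sT, T) = (s+ι)ᵃ (s-ι)ᵇ T^{a+b}`. -/
theorem subst_charPoly (s ι : ℂ) (a b : ℕ) {F : MvPolynomial (Fin 2) ℂ}
    (hF : F = (X 0 + C ι * X 1) ^ a * (X 0 - C ι * X 1) ^ b) :
    aeval ![Polynomial.C s * Polynomial.X, Polynomial.X] F =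
      Polynomial.C ((s + ι) ^ a * (s - ι) ^ b) * Polynomial.X ^ (a + b) := by
  have e1 : aeval ![Polynomial.C s * Polynomial.X, Polynomial.X] (X 0 + C ι * X 1 :
      MvPolynomial (Fin 2) ℂ) = Polynomial.C (s + ι) * Polynomial.X := by
    simp only [map_add, map_mul, aeval_X, aeval_C, Matrix.cons_val_zero, Matrix.cons_val_one,
      Polynomial.algebraMap_eq]
    ring
  have e2 : aeval ![Polynomial.C s * Polynomial.X, Polynomial.X] (X 0 - C ι * X 1 :
      MvPolynomial (Fin 2) ℂ) = Polynomial.C (s - ι) * Polynomial.X := by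
    simp only [map_sub, map_mul, aeval_X, aeval_C, Matrix.cons_val_zero, Matrix.cons_val_one,
      Polynomial.algebraMap_eq]
    ring
  rw [hF, map_mul, map_pow, map_pow, e1, e2, map_mul, map_pow, map_pow]
  ring

/-- THE FUNCTIONAL IDENTITY (substitute `X₀ ↦ ±ιT`):
`Σ_{j+k=K} (ιʲ + (-ι)ʲ) [X₀ʲX₁ᵏ] F_{a,b} = 𝟙[K = a+b]·((2ι)ᵃ 0ᵇ + 0ᵃ (-2ι)ᵇ)`. -/
theorem sum_support_charPoly (ι : ℂ) (a b K : ℕ) {F : MvPolynomial (Fin 2) ℂ}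
    (hF : F = (X 0 + C ι * X 1) ^ a * (X 0 - C ι * X 1) ^ b) :
    ∑ m ∈ F.support, coeff m F * (if m 0 + m 1 = K then ι ^ m 0 + (-ι) ^ m 0 else 0) =
      if K = a + b then (ι + ι) ^ a * (ι - ι) ^ b + (-ι + ι) ^ a * (-ι - ι) ^ b else 0 := by
  have h : ∀ s : ℂ, ∑ m ∈ F.support, coeff m F * (if m 0 + m 1 = K then s ^ m 0 else 0) =
      if K = a + b then (s + ι) ^ a * (s - ι) ^ b else 0 := fun s => by
    rw [← coeff_subst, subst_charPoly s ι a b hF, Polynomial.coeff_C_mul_X_pow]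
  calc ∑ m ∈ F.support, coeff m F * (if m 0 + m 1 = K then ι ^ m 0 + (-ι) ^ m 0 else 0)
      = ∑ m ∈ F.support, (coeff m F * (if m 0 + m 1 = K then ι ^ m 0 else 0) +
            coeff m F * (if m 0 + m 1 = K then (-ι) ^ m 0 else 0)) := by
        refine Finset.sum_congr rfl fun m _ => ?_
        split_ifs <;> ring
    _ = (if K = a + b then (ι + ι) ^ a * (ι - ι) ^ b else 0) +
          (if K = a + b then (-ι + ι) ^ a * (-ι - ι) ^ b else 0) := by
        rw [Finset.sum_add_distrib, h ι, h (-ι)]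
    _ = _ := by split_ifs <;> ring

/-- Case analysis of `𝟙[2n = a+b]·((2ι)ᵃ 0ᵇ + 0ᵃ (-2ι)ᵇ)` on the grid `a, b ≤ 2n` (`n ≥ 1`): it is
`(2ι)^{2n}` exactly on `S = {(2n,0),(0,2n)}` and `0` elsewhere. -/
theorem indicator_eq (ι : ℂ) {n a b : ℕ} (hn : 0 < n) (ha : a ≤ 2 * n) (hb : b ≤ 2 * n) :
    (if 2 * n = a + b then (ι + ι) ^ a * (ι - ι) ^ b + (-ι + ι) ^ a * (-ι - ι) ^ b else 0) =
      if (a = 2 * n ∧ b = 0) ∨ (a = 0 ∧ b = 2 * n) then (2 * ι) ^ (2 * n) else 0 := by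
  have e1 : ι + ι = 2 * ι := by ring
  have e2 : -ι - ι = -(2 * ι) := by ring
  rw [e1, e2, sub_self, neg_add_cancel]
  have h2n : 2 * n ≠ 0 := by omega
  by_cases hS : (a = 2 * n ∧ b = 0) ∨ (a = 0 ∧ b = 2 * n)
  · rw [if_pos hS]
    rcases hS with ⟨rfl, rfl⟩ | ⟨rfl, rfl⟩
    · rw [if_pos (Nat.add_zero _).symm]
      simp only [pow_zero, mul_one, zero_pow h2n, add_zero]
    · rw [if_pos (Nat.zero_add _).symm]
      simp only [pow_zero, one_mul, zero_pow h2n, zero_add, (even_two_mul n).neg_pow]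
  · rw [if_neg hS]
    split_ifs with hab
    · have ha0 : a ≠ 0 := fun h => hS (Or.inr ⟨h, by omega⟩)
      have hb0 : b ≠ 0 := fun h => hS (Or.inl ⟨by omega, h⟩)
      rw [zero_pow ha0, zero_pow hb0, mul_zero, zero_mul, add_zero]
    · rfl

/-- The integer weights `e_j = 2(-d)^{j/2}` (`j` even), `0` (`j` odd) are `ιʲ + (-ι)ʲ`. -/
theorem cast_evenWeight (d : ℕ) {ι : ℂ} (hι : ι ^ 2 = -(d : ℂ)) (j : ℕ) :
    (((if Even j then 2 * (-(d : ℤ)) ^ (j / 2) else 0 : ℤ)) : ℂ) = ι ^ j + (-ι) ^ j := by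
  rcases Nat.even_or_odd j with ⟨i, rfl⟩ | hj
  · have h2 : (i + i) / 2 = i := by omega
    rw [if_pos ⟨i, rfl⟩, h2, Even.neg_pow ⟨i, rfl⟩, ← two_mul i, pow_mul, hι]
    push_cast
    ring
  · rw [if_neg (Nat.not_even_iff_odd.mpr hj), hj.neg_pow]
    push_cast
    ring

/-! ### The grid functional -/

/-- THE EXTRACTION: with `V` the Vandermonde matrix on `0..4n`, `W_{jk} = 𝟙[j+k=2n] e_j` and
`L = (adj V)ᵀ W (adj V)`, the grid functional `Σ_{x,y ≤ 4n} L_{xy} F_{a,b}(x,y)` equals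
`(det V)² · Σ_{j+k=2n} (ιʲ + (-ι)ʲ)[X₀ʲX₁ᵏ] F_{a,b}` for `a, b ≤ 2n`. -/
theorem grid_sum_eq {n d : ℕ} (ι : ℂ) (hι : ι ^ 2 = -(d : ℂ))
    {V W : Matrix (Fin (4 * n + 1)) (Fin (4 * n + 1)) ℤ}
    (hV : V = Matrix.vandermonde fun i : Fin (4 * n + 1) => ((i : ℕ) : ℤ))
    (hW : W = Matrix.of fun j k : Fin (4 * n + 1) =>
      if (j : ℕ) + k = 2 * n then (if Even (j : ℕ) then 2 * (-(d : ℤ)) ^ ((j : ℕ) / 2) else 0) else 0)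
    {a b : ℕ} (ha : a ≤ 2 * n) (hb : b ≤ 2 * n) {F : MvPolynomial (Fin 2) ℂ}
    (hF : F = (X 0 + C ι * X 1) ^ a * (X 0 - C ι * X 1) ^ b) :
    ∑ p : Fin (4 * n + 1) × Fin (4 * n + 1),
        ((V.adjugate.transpose * W * V.adjugate) p.1 p.2 : ℂ) *
          eval ![((p.1 : ℕ) : ℂ), ((p.2 : ℕ) : ℂ)] F =
      (V.det : ℂ) ^ 2 * ∑ m ∈ F.support,
        coeff m F * (if m 0 + m 1 = 2 * n then ι ^ m 0 + (-ι) ^ m 0 else 0) := by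
  set L := V.adjugate.transpose * W * V.adjugate with hL
  have hVx : ∀ x j : Fin (4 * n + 1), V x j = ((x : ℕ) : ℤ) ^ (j : ℕ) := fun x j => by
    rw [hV, Matrix.vandermonde_apply]
  have hWjk : ∀ j k : Fin (4 * n + 1), ((W j k : ℤ) : ℂ) =
      if (j : ℕ) + k = 2 * n then ι ^ (j : ℕ) + (-ι) ^ (j : ℕ) else 0 := fun j k => by
    rw [hW, Matrix.of_apply]
    by_cases h : (j : ℕ) + k = 2 * n
    · rw [if_pos h, if_pos h]
      exact cast_evenWeight d hι j
    · rw [if_neg h, if_neg h, Int.cast_zero]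
  -- the moments of `L` over `ℤ`, then over `ℂ`
  have hmom : ∀ j k : Fin (4 * n + 1),
      ∑ p : Fin (4 * n + 1) × Fin (4 * n + 1),
          ((p.1 : ℕ) : ℤ) ^ (j : ℕ) * L p.1 p.2 * ((p.2 : ℕ) : ℤ) ^ (k : ℕ) = V.det ^ 2 * W j k := by
    intro j k
    have h := sum_sum_sandwich V W j k
    rw [← hL] at h
    simp only [hVx] at h
    rw [← h, ← Fintype.sum_prod_type']
  have hmomC : ∀ j k : ℕ, j < 4 * n + 1 → k < 4 * n + 1 →
      ∑ p : Fin (4 * n + 1) × Fin (4 * n + 1),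
          ((p.1 : ℕ) : ℂ) ^ j * (L p.1 p.2 : ℂ) * ((p.2 : ℕ) : ℂ) ^ k =
        (V.det : ℂ) ^ 2 * (if j + k = 2 * n then ι ^ j + (-ι) ^ j else 0) := by
    intro j k hj hk
    have h := congrArg (Int.cast : ℤ → ℂ) (hmom ⟨j, hj⟩ ⟨k, hk⟩)
    simp only [Int.cast_sum, Int.cast_mul, Int.cast_pow, Int.cast_natCast, hWjk] at h
    exact h
  calc ∑ p : Fin (4 * n + 1) × Fin (4 * n + 1),
        (L p.1 p.2 : ℂ) * eval ![((p.1 : ℕ) : ℂ), ((p.2 : ℕ) : ℂ)] F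
      = ∑ p : Fin (4 * n + 1) × Fin (4 * n + 1), ∑ m ∈ F.support,
          coeff m F * (((p.1 : ℕ) : ℂ) ^ m 0 * (L p.1 p.2 : ℂ) * ((p.2 : ℕ) : ℂ) ^ m 1) := by
        refine Finset.sum_congr rfl fun p _ => ?_
        rw [eval_eq_sum_support, Finset.mul_sum]
        refine Finset.sum_congr rfl fun m _ => ?_
        ring
    _ = ∑ m ∈ F.support, coeff m F *
          ∑ p : Fin (4 * n + 1) × Fin (4 * n + 1),
            ((p.1 : ℕ) : ℂ) ^ m 0 * (L p.1 p.2 : ℂ) * ((p.2 : ℕ) : ℂ) ^ m 1 := by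
        rw [Finset.sum_comm]
        simp only [← Finset.mul_sum]
    _ = ∑ m ∈ F.support, coeff m F *
          ((V.det : ℂ) ^ 2 * (if m 0 + m 1 = 2 * n then ι ^ m 0 + (-ι) ^ m 0 else 0)) := by
        refine Finset.sum_congr rfl fun m hm => ?_
        have h0 := le_of_mem_support_charPoly hF hm 0
        have h1 := le_of_mem_support_charPoly hF hm 1
        rw [hmomC (m 0) (m 1) (by omega) (by omega)]
    _ = _ := by
        rw [Finset.mul_sum]
        refine Finset.sum_congr rfl fun m _ => ?_
        ring

/-- Summing `c ↦ c · g` over a finite sum of `Finsupp.single`s. -/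
theorem sum_support_sum_single {α : Type*} [Fintype α] (f : α → ℕ × ℕ) (c : α → ℤ)
    (g : ℕ × ℕ → ℂ) :
    ∑ xy ∈ (∑ p, Finsupp.single (f p) (c p)).support,
        (((∑ p, Finsupp.single (f p) (c p)) xy : ℤ) : ℂ) * g xy = ∑ p, (c p : ℂ) * g (f p) := by
  change ((∑ p, Finsupp.single (f p) (c p)).sum fun xy r => (r : ℂ) * g xy) = _
  rw [← Finsupp.sum_finsetSum_index (fun _ => by simp) (fun _ _ _ => by push_cast; ring)]
  exact Finset.sum_congr rfl fun p _ => Finsupp.sum_single_index (by simp)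

end WeilProjectorCoeff

open MvPolynomial WeilProjectorCoeff in
/-- **Stub S1 — Weil-projector coefficients exist** (registered stub `stub_weilProjectorCoefficients`
of the line `ch0-null-correspondence-support`, crux stmt-HodgeConjecture-1081): for `n, d ≥ 1` there are
`q : ℕ × ℕ →₀ ℤ` and `m ≥ 1` with `Σ q(x,y)(x + yi√d)ᵃ(x - yi√d)ᵇ = m·𝟙_S(a,b)` for all `a, b ≤ 2n`,
`S = {(2n,0),(0,2n)}`. Witness: `q(x,y) = (-1)ⁿ((adj V)ᵀ W adj V)_{xy}` on the grid `[0,4n]²`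
(`V` the Vandermonde matrix of the nodes `0..4n`, `W_{jk} = 𝟙[j+k=2n]·e_j`, `e_j = 2(-d)^{j/2}` for
`j` even and `0` for `j` odd) and `m = (det V)²(4d)ⁿ`. Proof: module docstring (Vandermonde extraction
of the functional `Σ_{j+k=2n} e_j [X₀ʲX₁ᵏ]`, evaluated by the substitutions `X₀ ↦ ±ιT`).
[cite: vanGeemen1994HodgeAV, proof of Thm. 6.12] -/
theorem stub_weilProjectorCoefficients : WeilProjectorCoefficients := by
  intro n d hn hd
  obtain ⟨ι, hιdef⟩ : ∃ ι : ℂ, ι = Complex.I * (Real.sqrt d : ℂ) := ⟨_, rfl⟩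
  have hι : ι ^ 2 = -(d : ℂ) := hιdef ▸ Literature.AlgebraicGeometry.HodgeTheory.I_mul_sqrt_sq d
  obtain ⟨V, hV⟩ : ∃ V : Matrix (Fin (4 * n + 1)) (Fin (4 * n + 1)) ℤ,
      V = Matrix.vandermonde fun i : Fin (4 * n + 1) => ((i : ℕ) : ℤ) := ⟨_, rfl⟩
  obtain ⟨W, hW⟩ : ∃ W : Matrix (Fin (4 * n + 1)) (Fin (4 * n + 1)) ℤ,
      W = Matrix.of fun j k : Fin (4 * n + 1) =>
        if (j : ℕ) + k = 2 * n then (if Even (j : ℕ) then 2 * (-(d : ℤ)) ^ ((j : ℕ) / 2) else 0)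
        else 0 := ⟨_, rfl⟩
  have hdet : V.det ≠ 0 := hV ▸ det_vandermonde_natCast_ne_zero (4 * n)
  refine ⟨∑ p : Fin (4 * n + 1) × Fin (4 * n + 1), Finsupp.single ((p.1 : ℕ), (p.2 : ℕ))
      ((-1) ^ n * (V.adjugate.transpose * W * V.adjugate) p.1 p.2),
    V.det.natAbs ^ 2 * (4 * d) ^ n,
    Nat.mul_pos (pow_pos (Int.natAbs_pos.mpr hdet) 2) (pow_pos (by omega) n), ?_⟩
  intro a b ha hb
  obtain ⟨F, hF⟩ : ∃ F : MvPolynomial (Fin 2) ℂ, F = (X 0 + C ι * X 1) ^ a * (X 0 - C ι * X 1) ^ b :=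
    ⟨_, rfl⟩
  rw [sum_support_sum_single]
  dsimp only
  have h1 : ((V.det.natAbs : ℕ) : ℂ) ^ 2 = (V.det : ℂ) ^ 2 := by
    rw [Nat.cast_natAbs, ← Int.cast_pow, sq_abs, Int.cast_pow]
  have hm : ((V.det.natAbs ^ 2 * (4 * d) ^ n : ℕ) : ℂ) = (V.det : ℂ) ^ 2 * (4 * (d : ℂ)) ^ n := by
    rw [Nat.cast_mul, Nat.cast_pow, h1, Nat.cast_pow, Nat.cast_mul, Nat.cast_ofNat]
  calc ∑ p : Fin (4 * n + 1) × Fin (4 * n + 1),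
        ((((-1) ^ n * (V.adjugate.transpose * W * V.adjugate) p.1 p.2 : ℤ)) : ℂ) *
          weilCharacter d p.1 p.2 a b
      = (-1) ^ n * ∑ p : Fin (4 * n + 1) × Fin (4 * n + 1),
          ((V.adjugate.transpose * W * V.adjugate) p.1 p.2 : ℂ) *
            eval ![((p.1 : ℕ) : ℂ), ((p.2 : ℕ) : ℂ)] F := by
        rw [Finset.mul_sum]
        refine Finset.sum_congr rfl fun p _ => ?_
        rw [weilCharacter_eq_eval hιdef hF]
        push_cast
        ring
    _ = (-1) ^ n * ((V.det : ℂ) ^ 2 *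
          if (a = 2 * n ∧ b = 0) ∨ (a = 0 ∧ b = 2 * n) then (2 * ι) ^ (2 * n) else 0) := by
        rw [grid_sum_eq ι hι hV hW ha hb hF, sum_support_charPoly ι a b (2 * n) hF,
          indicator_eq ι hn ha hb]
    _ = _ := by
        rw [hm]
        split_ifs
        · have e3 : (2 * ι) ^ (2 * n) = (-1) ^ n * (4 * (d : ℂ)) ^ n := by
            rw [pow_mul, ← mul_pow]
            congr 1
            rw [mul_pow, hι]
            ring
          rw [e3]
          have h11 : (-1 : ℂ) ^ n * (-1) ^ n = 1 := by rw [← mul_pow]; simp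
          linear_combination (V.det : ℂ) ^ 2 * (4 * (d : ℂ)) ^ n * h11
        · simp

end Summit.HodgeConjecture.HodgeConjecture.Theorems.Ch0Null

end
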